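import Summits.HodgeConjecture.HodgeConjecture.Theorems.F0P3U3LengthLeTwoOfEmbeds                   -- ★ p829972 J1 `u3PrincipalSeriesLengthLeTwo_of_embeds (hN1) (hN2)`
import Summits.HodgeConjecture.HodgeConjecture.Theorems.F0P3U3SubrepSquareIntegrableOfExponents     -- ★ p830391 J2 `u3PrincipalSeriesSubrepSquareIntegrable_of_exponents (hN5) (hN1) (hN2)`
import Summits.HodgeConjecture.HodgeConjecture.Theorems.F0P3U3PrincipalSeriesJacquetFiltrationHolds  -- ★ p832625 N1 `U3PrincipalSeriesJacquetFiltration_holds` (B-p10)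
import Summits.HodgeConjecture.HodgeConjecture.Theorems.F0P3U3ConstituentEmbedsOfJacquet              -- ★ p831765 N2 ⇐ N1 `u3PrincipalSeriesConstituentEmbeds_of_jacquetFiltration` (F0P3-p01)
import HarnessLib

/-!
# Crux `H413`, Keys∕KeysCaseTwo pay-down — the U(3) principal-series letters N2, N3 HOLD (N1 is ★); N5′ ⇐ N5 (hypothesis-free folds)

Cell hodgecm-mathlib (D-0151), FLOOR 0, crux item H413 = stmt-HodgeConjecture-24833 (`--supports`, helper; desk F0P3b-plan (g10) word
2026-08-31T19:36:18Z, row (B)).  HC_CM is proved only modulo the 2 remaining named inputs (hLiu418, h413) until rung 0 closes; nothing here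
proves HC_CM.

By name, for every CM field `L` (THEOREMS ONLY, one-line compositions of ★ modules; no definition, no named fact, no instance):
* N1 [Casselman1995, L. 7.1.1 (a)] is ★ `F0P3U3PrincipalSeriesJacquetFiltrationHolds.U3PrincipalSeriesJacquetFiltration_holds L` (B-p10 (g21),
  over A-p13∕A-p19's cell analysis) — used by name below, not restated;
* `u3PrincipalSeriesConstituentEmbeds_holds L : U3PrincipalSeriesConstituentEmbeds L` — N2 [Casselman1995, Cor. 6.3.9; Thm. 5.3.1], ★
  `F0P3U3ConstituentEmbedsOfJacquet.u3PrincipalSeriesConstituentEmbeds_of_jacquetFiltration` (F0P3-p01 (g10)) at N1;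
* `u3PrincipalSeriesLengthLeTwo_holds L : U3PrincipalSeriesLengthLeTwo L` — N3 [Casselman1995, Cor. 7.1.2; Rogawski1990, §12.2 p. 173
  «at most two constituents»], ★ J1 `F0P3U3LengthLeTwoOfEmbeds.u3PrincipalSeriesLengthLeTwo_of_embeds` at N1, N2;
* `u3PrincipalSeriesSubrepSquareIntegrable_of_N5 L (hN5) : U3PrincipalSeriesSubrepSquareIntegrable L` — N5′ from the ONE remaining
  analytic letter N5 ★ `U3SquareIntegrableExponents` [Casselman1995, Thm. 4.4.6], ★ J2
  `F0P3U3SubrepSquareIntegrableOfExponents.u3PrincipalSeriesSubrepSquareIntegrable_of_exponents` at N5, N1, N2.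
So of the five U(3) letters of the Keys line, N1∕N2∕N3 are theorems and N5′ is N5; the line `Cruxes/H413/Lines/F0_P3_KeysCaseTwoPaydown`
rests on the printed letters N4 (Keys' reducibility) and N5 (Casselman's criterion) plus the in-house S2.

## References
[Casselman1995] L. 7.1.1 (a), Cor. 6.3.9, Cor. 7.1.2, Thm. 4.4.6, Thm. 5.3.1 · [BernsteinZelevinsky1977] §2.12, Thm. 2.4 (b) · [Rogawski1990] §12.2 pp. 173–174.
-/

set_option autoImplicit false
-- the mandated namespace has the single-problem summit's repeated segment (`HodgeConjecture.HodgeConjecture`)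
set_option linter.dupNamespace false

noncomputable section

open NumberField IsDedekindDomain
open Literature.NumberTheory.Automorphic Literature.NumberTheory.Automorphic.UnitaryGroup

namespace Summit.HodgeConjecture.HodgeConjecture.Cruxes.H413.F0P3U3PrincipalSeriesLettersHold

variable (L : Type) [Field L] [NumberField L] [IsCMField L]

/-- **N2 holds**: every constituent of `i_G(χ₁, χ₂)` embeds into `i_G(χ₁, χ₂)` or into `i_G(χ̄₁⁻¹, χ₂)` (★ F0P3-p01's junction at ★ N1).
[cite: Casselman1995, Cor. 6.3.9 p. 60; Thm. 5.3.1] [cite: BernsteinZelevinsky1977, Thm. 2.4 (b)] [cite: Rogawski1990, §12.2 p. 173] -/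
theorem u3PrincipalSeriesConstituentEmbeds_holds : U3PrincipalSeriesConstituentEmbeds L :=
  F0P3U3ConstituentEmbedsOfJacquet.u3PrincipalSeriesConstituentEmbeds_of_jacquetFiltration L
    (F0P3U3PrincipalSeriesJacquetFiltrationHolds.U3PrincipalSeriesJacquetFiltration_holds L)

/-- **N3 holds**: `i_G(χ₁, χ₂)` has no chain `⊥ < N₁ < N₂ < ⊤` of subrepresentations — at most two constituents (★ J1 at ★ N1, ★ N2).
[cite: Casselman1995, Cor. 7.1.2 p. 67] [cite: Rogawski1990, §12.2 p. 173] -/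
theorem u3PrincipalSeriesLengthLeTwo_holds : U3PrincipalSeriesLengthLeTwo L :=
  F0P3U3LengthLeTwoOfEmbeds.u3PrincipalSeriesLengthLeTwo_of_embeds L (F0P3U3PrincipalSeriesJacquetFiltrationHolds.U3PrincipalSeriesJacquetFiltration_holds L)
    (u3PrincipalSeriesConstituentEmbeds_holds L)

/-- **N5′ from N5 alone**: a proper non-zero subrepresentation of `i_G(χ₁, χ₂)` with unitary central character is square-integrable modulo the
centre iff `χ₁` decays on the split torus — ★ J2 at the letter N5 (Casselman's criterion) and ★ N1, ★ N2. [cite: Casselman1995, Thm. 4.4.6 p. 47; Lemma 7.1.1 (a)]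
[cite: Rogawski1990, §12.2 pp. 173–174] -/
theorem u3PrincipalSeriesSubrepSquareIntegrable_of_N5 (hN5 : U3SquareIntegrableExponents L) :
    U3PrincipalSeriesSubrepSquareIntegrable L :=
  F0P3U3SubrepSquareIntegrableOfExponents.u3PrincipalSeriesSubrepSquareIntegrable_of_exponents L hN5
    (F0P3U3PrincipalSeriesJacquetFiltrationHolds.U3PrincipalSeriesJacquetFiltration_holds L) (u3PrincipalSeriesConstituentEmbeds_holds L)

end Summit.HodgeConjecture.HodgeConjecture.Cruxes.H413.F0P3U3PrincipalSeriesLettersHold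

end
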